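import Summits.CriticalPhenomena.PercolationContinuityZ3.Theorems.Transplant.FKConnectivityAllQPat3ThetaP11Star
import Summits.CriticalPhenomena.PercolationContinuityZ3.Theorems.Transplant.FKConnectivityAllQPat3RingP11Star
import HarnessLib

/-!
# Connectivity correlation inequalities for `φ_{w,q}`, every `q > 0` — THE THETA AND RING LEAF LEMMAS OVER `famP11` (census g39 §4
# certificates `…Pat3{Theta,Ring}P11{Tsym,Star}.lean` plugged into `FK.shape3C_nonneg_of_rows`; census g40)

Theorems file (`--supports stmt-CriticalPhenomena-4575`), census lineage (gen 40) of LANE 2's FK sub-programme; builds on p205010 (kernel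
theorem, internal audit signed; external expert review pending).  No named facts, no sorries; standard axioms.

WHY these and not census g36/g37's THETA/RING theorems: those certificates use the `famPlus` members `C3`, `C1` which are NOT valid on
bridge-topped (𝒦) pieces (census g39 §2); census g39 re-certified THETA/RING over `famP11` + orbit cells, transcribed here.
SETTING: THETA — names `p : Fin 5 → V`, poles `p 0, p 1`, three piece minors all glued at `(p 0, p 1)` with inner marks `p 2, p 3, p 4`;
RING — names `p : Fin 6 → V`, triangle `p 0, p 1, p 2`, pieces at `(1,0), (0,2), (2,1)` with inner marks `p 3, p 4, p 5`; no plain edges.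
* `FK.thetaP11_{tsym,starX}_level_nonneg`, `FK.ringP11_{tsym,starX}_level_nonneg`.
[cite: AyyerLinussonRavichandran2025, §7 (p. 22)]
-/

namespace Summit.CriticalPhenomena.PercolationContinuityZ3.Theorems

namespace FK

open SimpleGraph Literature.Probability.LatticeModels Literature.Probability.Percolation
open scoped Classical

variable {V : Type*}
/-! ### THE THETA / RING LEAF LEMMAS OVER famP11 (census g39 §4): certificates plugged into `FK.shape3C_nonneg_of_rows` -/

section L_thetaP

/-- Empty skeleton: nothing to check. [folklore] -/
theorem thetaPSkel_ne {p : Fin 5 → V} : ∀ e ∈ thetaPSkel, p e.1 ≠ p e.2 := by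
  intro e he; simp [thetaPSkel] at he

/-- Empty skeleton: nothing to check. [folklore] -/
theorem thetaPSkel_nodup {p : Fin 5 → V} : (thetaPSkel.map (pedge p)).Nodup := by
  simp [thetaPSkel]

/-- Empty skeleton: nothing to check. [folklore] -/
theorem thetaPSkel_marks {p : Fin 5 → V} : ∀ e ∈ thetaPSkel, (p e.1 ≠ p 2 ∧ p e.2 ≠ p 2) ∧ (p e.1 ≠ p 3 ∧ p e.2 ≠ p 3) ∧ (p e.1 ≠ p 4 ∧ p e.2 ≠ p 4) := by
  intro e he; simp [thetaPSkel] at he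

variable [Fintype V] {p : Fin 5 → V} {EK CK E₁ C₁ E₂ C₂ : Finset (Sym2 V)} {VK V₁ V₂ : Set V}

/-- **LEAF THETA (famP11) × T_sym** (kernel certificate `FK.thetaP_tsym_rows`): piece minors `(E_K, C_K)`, `(E₁, C₁)`, `(E₂, C₂)` at the named slots
`(0,1)`, `(0,1)`, `(0,1)` with inner marks `p 2, p 3, p 4`, each carrying `famP11` levelwise nonnegative at its `(u, v, m)`;
then the target is levelwise nonnegative at `(p 2, p 3, p 4)` on the composite minor. [cite: AyyerLinussonRavichandran2025, §7 (p. 22)] -/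
theorem thetaP11_tsym_level_nonneg (hinj : Function.Injective p)
    (hEK : ∀ e ∈ (↑(EK ∪ CK) : Set (Sym2 V)), ∀ z ∈ e, z ∈ VK) (hE1 : ∀ e ∈ (↑(E₁ ∪ C₁) : Set (Sym2 V)), ∀ z ∈ e, z ∈ V₁)
    (hE2 : ∀ e ∈ (↑(E₂ ∪ C₂) : Set (Sym2 V)), ∀ z ∈ e, z ∈ V₂)
    (hpK : ∀ a, p a ∈ VK → p a = p 0 ∨ p a = p 1 ∨ p a = p 2) (hp1 : ∀ a, p a ∈ V₁ → p a = p 0 ∨ p a = p 1 ∨ p a = p 3)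
    (hp2 : ∀ a, p a ∈ V₂ → p a = p 0 ∨ p a = p 1 ∨ p a = p 4)
    (hK1 : ∀ z ∈ VK, z ∈ V₁ → z = p 0 ∨ z = p 1) (hK2 : ∀ z ∈ VK, z ∈ V₂ → z = p 0 ∨ z = p 1)
    (h12 : ∀ z ∈ V₁, z ∈ V₂ → z = p 0 ∨ z = p 1) (hmK : p 2 ∈ VK) (hm1 : p 3 ∈ V₁) (hm2 : p 4 ∈ V₂)
    (hdK : Disjoint (plainSet p thetaPSkel) EK) (hd1 : Disjoint (plainSet p thetaPSkel ∪ EK) E₁)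
    (hd2 : Disjoint (plainSet p thetaPSkel ∪ EK ∪ E₁) E₂)
    (hvalK : ∀ i ν, 0 ≤ lev2C EK CK (p 0) (p 1) (p 2) (famGet famP11 i) ν)
    (hval1 : ∀ i ν, 0 ≤ lev2C E₁ C₁ (p 0) (p 1) (p 3) (famGet famP11 i) ν)
    (hval2 : ∀ i ν, 0 ≤ lev2C E₂ C₂ (p 0) (p 1) (p 4) (famGet famP11 i) ν) (μ : ℕ) :
    0 ≤ lev2C (plainSet p thetaPSkel ∪ EK ∪ E₁ ∪ E₂) (CK ∪ C₁ ∪ C₂) (p 2) (p 3) (p 4) tsym2Tab μ :=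
  shape3C_nonneg_of_rows hinj hEK hE1 hE2 hpK hp1 hp2 hK1 hK2 h12 hmK hm1 hm2 (hinj.ne (by decide)) (hinj.ne (by decide))
    (hinj.ne (by decide)) rfl rfl rfl rfl rfl rfl rfl rfl rfl (by decide) (by decide) (by decide) rfl rfl rfl (thetaPSkel_ne)
    (thetaPSkel_nodup) (thetaPSkel_marks) hdK hd1 hd2 tsym2Tab (by norm_num) thetaP_tsym_rows
    (Prod3.ofIdx_nonneg (famGet_famP11orb_nonneg hvalK) (famGet_famP11orb_nonneg hval1) (famGet_famP11orb_nonneg hval2)) μ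

/-- **LEAF THETA (famP11) × STAR_x** (kernel certificate `FK.thetaP_starX_rows`): piece minors `(E_K, C_K)`, `(E₁, C₁)`, `(E₂, C₂)` at the named slots
`(0,1)`, `(0,1)`, `(0,1)` with inner marks `p 2, p 3, p 4`, each carrying `famP11` levelwise nonnegative at its `(u, v, m)`;
then the target is levelwise nonnegative at `(p 2, p 3, p 4)` on the composite minor. [cite: AyyerLinussonRavichandran2025, §7 (p. 22)] -/
theorem thetaP11_starX_level_nonneg (hinj : Function.Injective p)
    (hEK : ∀ e ∈ (↑(EK ∪ CK) : Set (Sym2 V)), ∀ z ∈ e, z ∈ VK) (hE1 : ∀ e ∈ (↑(E₁ ∪ C₁) : Set (Sym2 V)), ∀ z ∈ e, z ∈ V₁)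
    (hE2 : ∀ e ∈ (↑(E₂ ∪ C₂) : Set (Sym2 V)), ∀ z ∈ e, z ∈ V₂)
    (hpK : ∀ a, p a ∈ VK → p a = p 0 ∨ p a = p 1 ∨ p a = p 2) (hp1 : ∀ a, p a ∈ V₁ → p a = p 0 ∨ p a = p 1 ∨ p a = p 3)
    (hp2 : ∀ a, p a ∈ V₂ → p a = p 0 ∨ p a = p 1 ∨ p a = p 4)
    (hK1 : ∀ z ∈ VK, z ∈ V₁ → z = p 0 ∨ z = p 1) (hK2 : ∀ z ∈ VK, z ∈ V₂ → z = p 0 ∨ z = p 1)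
    (h12 : ∀ z ∈ V₁, z ∈ V₂ → z = p 0 ∨ z = p 1) (hmK : p 2 ∈ VK) (hm1 : p 3 ∈ V₁) (hm2 : p 4 ∈ V₂)
    (hdK : Disjoint (plainSet p thetaPSkel) EK) (hd1 : Disjoint (plainSet p thetaPSkel ∪ EK) E₁)
    (hd2 : Disjoint (plainSet p thetaPSkel ∪ EK ∪ E₁) E₂)
    (hvalK : ∀ i ν, 0 ≤ lev2C EK CK (p 0) (p 1) (p 2) (famGet famP11 i) ν)
    (hval1 : ∀ i ν, 0 ≤ lev2C E₁ C₁ (p 0) (p 1) (p 3) (famGet famP11 i) ν)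
    (hval2 : ∀ i ν, 0 ≤ lev2C E₂ C₂ (p 0) (p 1) (p 4) (famGet famP11 i) ν) (μ : ℕ) :
    0 ≤ lev2C (plainSet p thetaPSkel ∪ EK ∪ E₁ ∪ E₂) (CK ∪ C₁ ∪ C₂) (p 2) (p 3) (p 4) starXTab μ :=
  shape3C_nonneg_of_rows hinj hEK hE1 hE2 hpK hp1 hp2 hK1 hK2 h12 hmK hm1 hm2 (hinj.ne (by decide)) (hinj.ne (by decide))
    (hinj.ne (by decide)) rfl rfl rfl rfl rfl rfl rfl rfl rfl (by decide) (by decide) (by decide) rfl rfl rfl (thetaPSkel_ne)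
    (thetaPSkel_nodup) (thetaPSkel_marks) hdK hd1 hd2 starXTab (by norm_num) thetaP_starX_rows
    (Prod3.ofIdx_nonneg (famGet_famP11orb_nonneg hvalK) (famGet_famP11orb_nonneg hval1) (famGet_famP11orb_nonneg hval2)) μ

end L_thetaP

section L_ringP

/-- Empty skeleton: nothing to check. [folklore] -/
theorem ringPSkel_ne {p : Fin 6 → V} : ∀ e ∈ ringPSkel, p e.1 ≠ p e.2 := by
  intro e he; simp [ringPSkel] at he

/-- Empty skeleton: nothing to check. [folklore] -/
theorem ringPSkel_nodup {p : Fin 6 → V} : (ringPSkel.map (pedge p)).Nodup := by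
  simp [ringPSkel]

/-- Empty skeleton: nothing to check. [folklore] -/
theorem ringPSkel_marks {p : Fin 6 → V} : ∀ e ∈ ringPSkel, (p e.1 ≠ p 3 ∧ p e.2 ≠ p 3) ∧ (p e.1 ≠ p 4 ∧ p e.2 ≠ p 4) ∧ (p e.1 ≠ p 5 ∧ p e.2 ≠ p 5) := by
  intro e he; simp [ringPSkel] at he

variable [Fintype V] {p : Fin 6 → V} {EK CK E₁ C₁ E₂ C₂ : Finset (Sym2 V)} {VK V₁ V₂ : Set V}

/-- **LEAF RING (famP11) × T_sym** (kernel certificate `FK.ringP_tsym_rows`): piece minors `(E_K, C_K)`, `(E₁, C₁)`, `(E₂, C₂)` at the named slots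
`(1,0)`, `(0,2)`, `(2,1)` with inner marks `p 3, p 4, p 5`, each carrying `famP11` levelwise nonnegative at its `(u, v, m)`;
then the target is levelwise nonnegative at `(p 3, p 4, p 5)` on the composite minor. [cite: AyyerLinussonRavichandran2025, §7 (p. 22)] -/
theorem ringP11_tsym_level_nonneg (hinj : Function.Injective p)
    (hEK : ∀ e ∈ (↑(EK ∪ CK) : Set (Sym2 V)), ∀ z ∈ e, z ∈ VK) (hE1 : ∀ e ∈ (↑(E₁ ∪ C₁) : Set (Sym2 V)), ∀ z ∈ e, z ∈ V₁)
    (hE2 : ∀ e ∈ (↑(E₂ ∪ C₂) : Set (Sym2 V)), ∀ z ∈ e, z ∈ V₂)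
    (hpK : ∀ a, p a ∈ VK → p a = p 1 ∨ p a = p 0 ∨ p a = p 3) (hp1 : ∀ a, p a ∈ V₁ → p a = p 0 ∨ p a = p 2 ∨ p a = p 4)
    (hp2 : ∀ a, p a ∈ V₂ → p a = p 2 ∨ p a = p 1 ∨ p a = p 5)
    (hK1 : ∀ z ∈ VK, z ∈ V₁ → z = p 0 ∨ z = p 2) (hK2 : ∀ z ∈ VK, z ∈ V₂ → z = p 2 ∨ z = p 1)
    (h12 : ∀ z ∈ V₁, z ∈ V₂ → z = p 2 ∨ z = p 1) (hmK : p 3 ∈ VK) (hm1 : p 4 ∈ V₁) (hm2 : p 5 ∈ V₂)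
    (hdK : Disjoint (plainSet p ringPSkel) EK) (hd1 : Disjoint (plainSet p ringPSkel ∪ EK) E₁)
    (hd2 : Disjoint (plainSet p ringPSkel ∪ EK ∪ E₁) E₂)
    (hvalK : ∀ i ν, 0 ≤ lev2C EK CK (p 1) (p 0) (p 3) (famGet famP11 i) ν)
    (hval1 : ∀ i ν, 0 ≤ lev2C E₁ C₁ (p 0) (p 2) (p 4) (famGet famP11 i) ν)
    (hval2 : ∀ i ν, 0 ≤ lev2C E₂ C₂ (p 2) (p 1) (p 5) (famGet famP11 i) ν) (μ : ℕ) :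
    0 ≤ lev2C (plainSet p ringPSkel ∪ EK ∪ E₁ ∪ E₂) (CK ∪ C₁ ∪ C₂) (p 3) (p 4) (p 5) tsym2Tab μ :=
  shape3C_nonneg_of_rows hinj hEK hE1 hE2 hpK hp1 hp2 hK1 hK2 h12 hmK hm1 hm2 (hinj.ne (by decide)) (hinj.ne (by decide))
    (hinj.ne (by decide)) rfl rfl rfl rfl rfl rfl rfl rfl rfl (by decide) (by decide) (by decide) rfl rfl rfl (ringPSkel_ne)
    (ringPSkel_nodup) (ringPSkel_marks) hdK hd1 hd2 tsym2Tab (by norm_num) ringP_tsym_rows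
    (Prod3.ofIdx_nonneg (famGet_famP11orb_nonneg hvalK) (famGet_famP11orb_nonneg hval1) (famGet_famP11orb_nonneg hval2)) μ

/-- **LEAF RING (famP11) × STAR_x** (kernel certificate `FK.ringP_starX_rows`): piece minors `(E_K, C_K)`, `(E₁, C₁)`, `(E₂, C₂)` at the named slots
`(1,0)`, `(0,2)`, `(2,1)` with inner marks `p 3, p 4, p 5`, each carrying `famP11` levelwise nonnegative at its `(u, v, m)`;
then the target is levelwise nonnegative at `(p 3, p 4, p 5)` on the composite minor. [cite: AyyerLinussonRavichandran2025, §7 (p. 22)] -/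
theorem ringP11_starX_level_nonneg (hinj : Function.Injective p)
    (hEK : ∀ e ∈ (↑(EK ∪ CK) : Set (Sym2 V)), ∀ z ∈ e, z ∈ VK) (hE1 : ∀ e ∈ (↑(E₁ ∪ C₁) : Set (Sym2 V)), ∀ z ∈ e, z ∈ V₁)
    (hE2 : ∀ e ∈ (↑(E₂ ∪ C₂) : Set (Sym2 V)), ∀ z ∈ e, z ∈ V₂)
    (hpK : ∀ a, p a ∈ VK → p a = p 1 ∨ p a = p 0 ∨ p a = p 3) (hp1 : ∀ a, p a ∈ V₁ → p a = p 0 ∨ p a = p 2 ∨ p a = p 4)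
    (hp2 : ∀ a, p a ∈ V₂ → p a = p 2 ∨ p a = p 1 ∨ p a = p 5)
    (hK1 : ∀ z ∈ VK, z ∈ V₁ → z = p 0 ∨ z = p 2) (hK2 : ∀ z ∈ VK, z ∈ V₂ → z = p 2 ∨ z = p 1)
    (h12 : ∀ z ∈ V₁, z ∈ V₂ → z = p 2 ∨ z = p 1) (hmK : p 3 ∈ VK) (hm1 : p 4 ∈ V₁) (hm2 : p 5 ∈ V₂)
    (hdK : Disjoint (plainSet p ringPSkel) EK) (hd1 : Disjoint (plainSet p ringPSkel ∪ EK) E₁)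
    (hd2 : Disjoint (plainSet p ringPSkel ∪ EK ∪ E₁) E₂)
    (hvalK : ∀ i ν, 0 ≤ lev2C EK CK (p 1) (p 0) (p 3) (famGet famP11 i) ν)
    (hval1 : ∀ i ν, 0 ≤ lev2C E₁ C₁ (p 0) (p 2) (p 4) (famGet famP11 i) ν)
    (hval2 : ∀ i ν, 0 ≤ lev2C E₂ C₂ (p 2) (p 1) (p 5) (famGet famP11 i) ν) (μ : ℕ) :
    0 ≤ lev2C (plainSet p ringPSkel ∪ EK ∪ E₁ ∪ E₂) (CK ∪ C₁ ∪ C₂) (p 3) (p 4) (p 5) starXTab μ :=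
  shape3C_nonneg_of_rows hinj hEK hE1 hE2 hpK hp1 hp2 hK1 hK2 h12 hmK hm1 hm2 (hinj.ne (by decide)) (hinj.ne (by decide))
    (hinj.ne (by decide)) rfl rfl rfl rfl rfl rfl rfl rfl rfl (by decide) (by decide) (by decide) rfl rfl rfl (ringPSkel_ne)
    (ringPSkel_nodup) (ringPSkel_marks) hdK hd1 hd2 starXTab (by norm_num) ringP_starX_rows
    (Prod3.ofIdx_nonneg (famGet_famP11orb_nonneg hvalK) (famGet_famP11orb_nonneg hval1) (famGet_famP11orb_nonneg hval2)) μ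

end L_ringP

end FK

end Summit.CriticalPhenomena.PercolationContinuityZ3.Theorems
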